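import Summits.Ventures.YMGap.Thresholds.TwistedBochnerIntegrated
import Summits.Ventures.YMGap.Thresholds.TraceNormHessianSU3
import HarnessLib

/-!
# Venture YMGap — SU(3) TWISTED BOCHNER with the TRACE-NORM Hessian split: the hypothesis-free one-link Poincaré constant
# `K₃ = 12/7 − (64/105)|c|‖B‖_op` (`= 12/7 − (64/35)R` for the one-link law; g11: `12/7 − (97/50)R`)

HONEST FRAMING.  Venture file of the cell `pub-ymgap` (QuantumFields programme), seat engine-2 (g12); 0 compute.  Explicit
STRONG-COUPLING constants for ONE tilted Haar law `ν_B(dg) ∝ exp(3 Re tr(gB)) dg` on `SU(3)`; NOT weak coupling, NOT a continuum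
statement, NOT a Yang–Mills mass-gap claim.  No sharpness claimed (Haar truth `8/3`; the cell's two-engine FLOAT `E₁(−(3/5)·1) = 1.80`, here
`K₃(3/5) = 108/175 = 0.617`).

THE MECHANISM.  The instance `N = 3`, `θ = 1/5`, `η = 1`, `κ = (2/3)|c|‖B‖_op` of g12's `TwistedBochnerIntegrated.integral_twisted_bochner`, fed with the
trace-norm Hessian split `TraceNormHessianSU3.hess_pot_le_su3_tr` (`‖Z²₀‖_tr ≤ (2/3)‖Z‖²`; g11's Frobenius split gave `(1/√2)‖B‖_op`):
* `integral_exp_mul_Gam_le_twisted_su3_tr`: `(12/7 − (64/105)|c|‖B‖_op) ∫e^SΓ ≤ ∫e^S(L_S u)²` (every `SΓ` word cancels: `(1/10)(8/3) = (4/5)(1/3)`; the slacks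
  `−(2/25)∫e^SΓ(S,S)Γ`, `−(3/50)∫e^SΓ(S,u)²` are dropped);
* `su3_var_tilted_le_twisted_tr`, ★ `oneLinkPoincareSUN_su3_twisted_tr`: `OneLinkPoincareSUN 3 R (1/K)` whenever `0 < K` and `K + (64/35)R ≤ 12/7`
  (g11 `oneLinkPoincareSUN_su3_twisted`: `K + (97/50)R ≤ 12/7`; Bakry–Émery: `K = 3(1/2 − R)`); radius cap `600/679 → 15/16`; instances `(11/30, 25/26)`,
  `(2/5, 175/172)`, `(1/2, 5/4)`, `(3/5, 175/108)`.
WHAT IT BUYS (exact): slope `97/50 = 1.94 → 64/35 = 1.829`; `K` at `R = 2/5`: `0.938 → 0.983`; `1/2`: `0.744 → 0.800`; `3/5`: `0.550 → 0.617`.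
NOT CLAIMED: `SU(2)` (J-SC13 sharp); `N ≥ 4`; the CERTIFIED (H1 ∧ H2) column; sharpness; the rows (sibling files on the new modulus).

References: Bakry–Émery LNM 1123 (1985); Shen–Zhu–Zhu CMP 400 (2023) Lemma 4.1; g11's `TwistedBochnerSU3`, g12's `TwistedBochnerIntegrated`,
`TraceNormHessianSU3`; cell note `HOME/pub-ymgap-engine-2/TWISTED-BOCHNER-SUN.md` §4.
-/

noncomputable section

open scoped Matrix ComplexConjugate BigOperators Matrix.Norms.Frobenius ContDiff Topology
open Matrix Complex Finset MeasureTheory ProbabilityTheory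
open Literature.MathematicalPhysics.QuantumFieldTheory
open Literature.MathematicalPhysics.QuantumFieldTheory.SUNBakryEmery
open Summit.QuantumFields.BalabanUV.InfraRed.StrongCouplingDimensionalPoincare (poincare_pot_K)
open Summit.QuantumFields.BalabanUV.InfraRed.StrongCouplingDimensionalVariance (var_tilted_le_of_poincare_K)
open Summit.QuantumFields.BalabanUV.InfraRed.StrongCouplingPoincareDoorSUN (OneLinkPoincareSUN)

namespace Summit.Ventures.YMGap.TwistedBochner

/-! ### The twisted constant `12/7 − (64/35)R` -/

/-- **THE INTEGRATED TWISTED BOCHNER INEQUALITY ON `SU(3)`, trace-norm form**: for `S = c Re tr(·B)` with ANY `c`, `B` and every smooth `u`,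
`(12/7 − (64/105)|c|‖B‖_op) ∫e^SΓ(u,u) ≤ ∫e^S(L_S u)²` — the instance `N = 3`, `θ = 1/5`, `η = 1`, `κ = (2/3)|c|‖B‖_op` of
`integral_twisted_bochner` (the `SΓ` words cancel: `(1/10)(8/3) = (4/5)(1/3)`; the slacks `−(2/25)∫e^SΓ(S,S)Γ`, `−(3/50)∫e^SΓ(S,u)²` are dropped).
g11 (`integral_exp_mul_Gam_le_twisted_su3`): `12/7 − (32/35)|c|‖B‖_F/√6`. [folklore] -/
theorem integral_exp_mul_Gam_le_twisted_su3_tr (c : ℝ) (B : Matrix (Fin 3) (Fin 3) ℂ) {u : Matrix (Fin 3) (Fin 3) ℂ → ℝ}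
    (hu : ContDiff ℝ ∞ u) :
    (12 / 7 - 64 / 105 * (|c| * matrixOpNorm B)) * ∫ g : SUN 3, Real.exp (pot c B g) * Gam u u g ∂(haarSU 3) ≤
      ∫ g : SUN 3, Real.exp (pot c B g) * genL (pot c B) u g ^ 2 ∂(haarSU 3) := by
  have h := integral_twisted_bochner (N := 3) (by norm_num) c B hu (θ := 1 / 5) (η := 1) (κ := 2 / 3 * (|c| * matrixOpNorm B))
    (by norm_num) (hess_pot_le_su3_tr c B u)
  set IΓ := ∫ g : SUN 3, Real.exp (pot c B g) * Gam u u g ∂(haarSU 3)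
  set IA := ∫ g : SUN 3, Real.exp (pot c B g) * genL (pot c B) u g ^ 2 ∂(haarSU 3)
  set IP := ∫ g : SUN 3, Real.exp (pot c B g) * (pot c B g * Gam u u g) ∂(haarSU 3)
  set IW := ∫ g : SUN 3, Real.exp (pot c B g) * (Gam (pot c B) (pot c B) g * Gam u u g) ∂(haarSU 3) with hIW
  set IG := ∫ g : SUN 3, Real.exp (pot c B g) * Gam (pot c B) u g ^ 2 ∂(haarSU 3) with hIG
  have hW0 : 0 ≤ IW :=
    integral_nonneg fun g => mul_nonneg (Real.exp_pos _).le (mul_nonneg (Gam_self_nonneg _ _) (Gam_self_nonneg _ _))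
  have hG0 : 0 ≤ IG := integral_nonneg fun g => mul_nonneg (Real.exp_pos _).le (sq_nonneg _)
  have hκ : 0 ≤ |c| * matrixOpNorm B := mul_nonneg (abs_nonneg c) (matrixOpNorm_nonneg B)
  norm_num at h
  nlinarith [h, hW0, hG0, hκ]

/-- **The twisted one-link variance bound on `SU(3)`, trace-norm form** (hypothesis-free): for `B ∈ M₃(ℂ)`, every `0 < K ≤ 12/7 − (64/35)‖B‖_op`
and every `M`-Lipschitz `ψ`: `Var_{ν_B}(ψ) ≤ M²/K`, `ν_B(dg) ∝ exp(3 Re tr(gB)) dg`. [folklore] -/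
theorem su3_var_tilted_le_twisted_tr (B : Matrix (Fin 3) (Fin 3) ℂ) {K : ℝ} (hK : 0 < K)
    (hKle : K ≤ 12 / 7 - 64 / 35 * matrixOpNorm B)
    (ψ : Matrix.specialUnitaryGroup (Fin 3) ℂ → ℝ) (M : ℝ) (hM : 0 ≤ M)
    (hψ : ∀ a b, |ψ a - ψ b| ≤ M * suFrobDist a b) :
    Var[ψ; (haarProbability (Matrix.specialUnitaryGroup (Fin 3) ℂ)).tilted
        fun g => ((3 : ℕ) : ℝ) * ((g : Matrix (Fin 3) (Fin 3) ℂ) * B).trace.re] ≤ M ^ 2 / K := by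
  have h3 : (3 : ℕ) ≠ 0 := by norm_num
  have hc : |((3 : ℕ) : ℝ)| = 3 := by norm_num
  have hGam : ∀ {v : Matrix (Fin 3) (Fin 3) ℂ → ℝ}, ContDiff ℝ ∞ v →
      K * ∫ g : SUN 3, Real.exp (pot ((3 : ℕ) : ℝ) B g) * Gam v v g ∂(haarSU 3) ≤
        ∫ g : SUN 3, Real.exp (pot ((3 : ℕ) : ℝ) B g) * genL (pot ((3 : ℕ) : ℝ) B) v g ^ 2 ∂(haarSU 3) := by
    intro v hv
    have h := integral_exp_mul_Gam_le_twisted_su3_tr ((3 : ℕ) : ℝ) B hv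
    rw [hc] at h
    have hI : 0 ≤ ∫ g : SUN 3, Real.exp (pot ((3 : ℕ) : ℝ) B g) * Gam v v g ∂(haarSU 3) :=
      integral_nonneg fun g => mul_nonneg (Real.exp_pos _).le (Gam_self_nonneg _ _)
    have hKle' : K ≤ 12 / 7 - 64 / 105 * (3 * matrixOpNorm B) := by linarith
    exact (mul_le_mul_of_nonneg_right hKle' hI).trans h
  have hP : ∀ {F : Matrix (Fin 3) (Fin 3) ℂ → ℝ}, ContDiff ℝ ∞ F →
      K * ∫ g : SUN 3, Real.exp (pot ((3 : ℕ) : ℝ) B g) * (F g -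
          (∫ g : SUN 3, Real.exp (pot ((3 : ℕ) : ℝ) B g) * F g ∂(haarSU 3)) /
            (∫ g : SUN 3, Real.exp (pot ((3 : ℕ) : ℝ) B g) ∂(haarSU 3))) ^ 2 ∂(haarSU 3) ≤
        ∫ g : SUN 3, Real.exp (pot ((3 : ℕ) : ℝ) B g) * Gam F F g ∂(haarSU 3) :=
    fun hF => poincare_pot_K h3 ((3 : ℕ) : ℝ) B hK hGam hF
  exact var_tilted_le_of_poincare_K (N := 3) h3 B hK hP ψ M hM hψ

/-- **`OneLinkPoincareSUN 3 R (1/K)` — the twisted one-link Poincaré constant on `SU(3)`, trace-norm form** (hypothesis-free): for every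
`0 < K` and `R` with `K + (64/35)·R ≤ 12/7` (radius cap `R < 15/16`), on the ball `‖B‖_op ≤ R` every `M`-Lipschitz `ψ` has `Var_{ν_B}(ψ) ≤ M²/K`.
g11 (`oneLinkPoincareSUN_su3_twisted`): `K + (97/50)R ≤ 12/7`; Bakry–Émery: `1/(3(1/2 − R))`. [folklore] -/
theorem oneLinkPoincareSUN_su3_twisted_tr {R K : ℝ} (hK : 0 < K) (hKR : K + 64 / 35 * R ≤ 12 / 7) :
    OneLinkPoincareSUN 3 R (1 / K) := by
  intro B hB ψ M hM hψ
  have hKle : K ≤ 12 / 7 - 64 / 35 * matrixOpNorm B := by nlinarith [hB]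
  have h := su3_var_tilted_le_twisted_tr B hK hKle ψ M hM hψ
  calc Var[ψ; (haarProbability (Matrix.specialUnitaryGroup (Fin 3) ℂ)).tilted
          fun g => ((3 : ℕ) : ℝ) * ((g : Matrix (Fin 3) (Fin 3) ℂ) * B).trace.re] ≤ M ^ 2 / K := h
    _ = 1 / K * M ^ 2 := by ring

/-- At the cell's star radius `R = 11/30` (`β_W = 11/20`, `d = 4`): `OneLinkPoincareSUN 3 (11/30) (25/26)` (`K = 26/25`; g11: `1`; Bakry–Émery
`5/2`). [folklore] -/
theorem oneLinkPoincareSUN_su3_twisted_tr_elevenThirtieths : OneLinkPoincareSUN 3 (11 / 30) (25 / 26) := by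
  have h := oneLinkPoincareSUN_su3_twisted_tr (R := 11 / 30) (K := 26 / 25) (by norm_num) (by norm_num)
  norm_num at h ⊢
  exact h

/-- `OneLinkPoincareSUN 3 (2/5) (175/172)` (`K = 172/175`; g11: `K ≤ 12/7 − 97/125 = 0.938`). [folklore] -/
theorem oneLinkPoincareSUN_su3_twisted_tr_twoFifths : OneLinkPoincareSUN 3 (2 / 5) (175 / 172) := by
  have h := oneLinkPoincareSUN_su3_twisted_tr (R := 2 / 5) (K := 172 / 175) (by norm_num) (by norm_num)
  norm_num at h ⊢
  exact h

/-- At the Bakry–Émery cap `R = 1/2`: `OneLinkPoincareSUN 3 (1/2) (5/4)` (`K = 4/5`; g11: `100/74`). [folklore] -/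
theorem oneLinkPoincareSUN_su3_twisted_tr_half : OneLinkPoincareSUN 3 (1 / 2) (5 / 4) := by
  have h := oneLinkPoincareSUN_su3_twisted_tr (R := 1 / 2) (K := 4 / 5) (by norm_num) (by norm_num)
  norm_num at h ⊢
  exact h

/-- At the certified column's radius `R = 3/5`: `OneLinkPoincareSUN 3 (3/5) (175/108)` (`K = 108/175 = 0.617`; g11: `0.550`; the CERTIFIED
hypothesis H1 of the cell reads `OneLinkPoincareSUN 3 (3/5) (4/5)` — not claimed). [folklore] -/
theorem oneLinkPoincareSUN_su3_twisted_tr_threeFifths : OneLinkPoincareSUN 3 (3 / 5) (175 / 108) := by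
  have h := oneLinkPoincareSUN_su3_twisted_tr (R := 3 / 5) (K := 108 / 175) (by norm_num) (by norm_num)
  norm_num at h ⊢
  exact h

end Summit.Ventures.YMGap.TwistedBochner

end
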